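import Literature.Analysis.Complex.HolomorphicBanach
import Literature.Analysis.Complex.GateauxHolomorphicBall
import Literature.MathematicalPhysics.QuantumFieldTheory.Balaban1983to89.B10Eq17LocalSolution
import Literature.MathematicalPhysics.QuantumFieldTheory.Balaban1983to89.B13Eq119BPrime
import HarnessLib

/-!
# `Balaban1983to89.B13QuadAnalyticFrechet` — the cell's hypothesis structure `QuadAnalytic C C₂ R`
# ([Balaban1985Variational] Sect. C (49)–(55); [Balaban1988RG2Cluster] (1.13)) ALREADY implies that `C` is
# Fréchet-holomorphic and ANALYTIC on the ball `‖Y‖ < R` (Graves–Taylor–Hille–Zorn + [Chae1985] Thm 14.13):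
# the extra binders «`C̃` analytic» of `B10Eq17LocalSolution`, `B12LinearizAnalytic267`, `B13Eq119BPrime` discharged

statement-level skeleton of published theorems with citation tags; proofs where landed; nothing here is a claim about the Yang–Mills mass gap

Unit `lit-balaban-p24` gen 6 (Phase-2 proof seat; HOME `run/shared/lean/pub/lit-balaban/`, seat dir
`lit-balaban-p24/`), companion of the Analysis support file `Literature/Analysis/Complex/HolomorphicBanach.lean`
(p255311, [Chae1985] Thm 14.13 on ANY complex normed domain).  PDF held: `paper:balaban1985-cmp102-variational-background`
([Balaban1985Variational] = B11, journal page = PDF page + 276), `paper:balaban1987-cmp109-rg-i-small-field`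
([Balaban1987RG1] = B12), `paper:balaban1988-cmp116-rg-ii-cluster` ([Balaban1988RG2Cluster] = B13),
`paper:balaban1985-cmp102-uv-stability-3d` ([Balaban1985UV3] = B10).  WHAT IS REPRODUCED: SKELETON rows **B10.Eq17**
(«it is an analytic function of A», p. 260), **B12.Lineariz267 / p.267** («it is an analytic function of B»),
**B13.Eq1.19** (Ψ₁ analytic) — the ANALYTICITY INPUT «C̃ is analytic» of these rows, which the files of record
(`B10Eq17LocalSolution` r07 g9, `B12LinearizAnalytic267`, `B13Eq119BPrime` p32) carry as an EXTRA displayed binder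
`hCa : AnalyticOnNhd ℂ Ct {Y | ‖Y‖ < R}` next to the cell's typed hypothesis structure
`hC : B13Contraction113.QuadAnalytic Ct C₂ R` («ADDED HERE, to run the analytic implicit function theorem: `Ct` is
`AnalyticOnNhd ℂ` on `{Y : ‖Y‖ < R}`», header of `B12LinearizAnalytic267`).

WHAT IS PROVED (theorems only; no definition, no named fact, no `sorry`; nothing printed is asserted — the files of
record are used BY NAME and untouched):
* §1 `norm_le_of_quadAnalytic`: the quadratic bound of `QuadAnalytic` ([Balaban1985Variational] p.285 *"|C_j(…)| ≦
  C₂(…)²"*) bounds `C` by `|C₂|R²` on the ball `‖Y‖ < R`; `differentiableOn_of_quadAnalytic`: with the LINE analyticity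
  of `QuadAnalytic` (what the Cauchy formula (53) of [Balaban1985Variational] consumes) this is exactly the input of the
  GRAVES–TAYLOR–HILLE–ZORN theorem ([Chae1985] Thm 14.9, tree `GateauxHolomorphic.differentiableOn_of_gateaux_of_bounded`):
  `C` is complex Fréchet-differentiable on `‖Y‖ < R` (values in a Banach space `𝒳`);
  `analyticOnNhd_of_quadAnalytic`: hence ANALYTIC there ([Chae1985] Thm 14.13, tree
  `HolomorphicBanach.analyticOnNhd_of_differentiableOn`, p255311) — on ANY complex normed `𝒴`, complete `𝒳`.
* §2 the discharges, each the file-of-record theorem with `hCa := analyticOnNhd_of_quadAnalytic hC`: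
  `p267_analytic_function_of_B` (= `B12LinearizAnalytic267.p267_analytic_function_of_B`), `analyticOnNhd_Dt`,
  `differentiableOn_Dt`; `exists_eq17Local`, `exists_radius_eq17Local` (= `B10Eq17LocalSolution.…`, row B10.Eq17 in r07's
  local reading `Eq17Local`); `analyticOnNhd_psi1_of_quadAnalytic` (= `B13Eq119BPrime.analyticOnNhd_psi1_of_lineariz`,
  row B13.Eq1.19).  The same one-term substitution serves every `hCa`/`hCd` binder of `B12JacobianReal267`,
  `B12JacobianTrLog268`, `B12SecondOrder267`, `B12TrLogBranch268`, `B12TrLogReal268`, `B12ZeroCoupling268` (not restated).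
HONEST SCOPE: on a finite lattice the configuration spaces are finite-dimensional and the tree's Osgood lemma would do;
the point is that the ABSTRACT carriers `𝒴`, `𝒳` of these files are arbitrary complex normed / Banach spaces, where only
p255311 applies.  Nothing of B10/B12/B13 is asserted; no SKELETON head changes by this file alone (owners r07, r09/r20,
r10 decide the cells).
-/

noncomputable section

open Metric Set Filter Topology

namespace Literature.MathematicalPhysics.QuantumFieldTheory.Balaban1983to89.B13QuadAnalyticFrechet

open Literature.Analysis.Complex
open Literature.MathematicalPhysics.QuantumFieldTheory.Balaban1983to89.B13Contraction113 (QuadAnalytic)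

/-! ## §1 `QuadAnalytic` ⇒ bounded + G-holomorphic ⇒ Fréchet-holomorphic ⇒ analytic on the ball -/

section Domain

variable {𝒴 : Type*} [NormedAddCommGroup 𝒴]

/-- The domain `{Y | ‖Y‖ < R}` is open. [cite: Balaban1985Variational, (51) p.285] -/
theorem isOpen_setOf_norm_lt (R : ℝ) : IsOpen {Y : 𝒴 | ‖Y‖ < R} :=
  isOpen_lt continuous_norm continuous_const

end Domain

section Ball

variable {𝒳 𝒴 : Type*} [NormedAddCommGroup 𝒳] [NormedSpace ℂ 𝒳] [NormedAddCommGroup 𝒴] [NormedSpace ℂ 𝒴]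
  {C : 𝒴 → 𝒳} {C₂ R : ℝ}

/-- **The quadratic bound bounds `C` on the ball**: `‖C(Y)‖ ≤ C₂‖Y‖² ≤ |C₂| R²` for `‖Y‖ < R`
([Balaban1985Variational] p. 285 *"|C_j(L^jηA′ − L^jηHX)| ≦ C₂(L^jη|A′| + L^jη|HX|)²"*, in the cell's typed form
`QuadAnalytic.quad`). [cite: Balaban1985Variational, (52) p.285] -/
theorem norm_le_of_quadAnalytic (hC : QuadAnalytic C C₂ R) {Y : 𝒴} (hY : Y ∈ ball (0 : 𝒴) R) :
    ‖C Y‖ ≤ |C₂| * R ^ 2 := by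
  rw [mem_ball_zero_iff] at hY
  calc ‖C Y‖ ≤ C₂ * ‖Y‖ ^ 2 := hC.quad Y hY
    _ ≤ |C₂| * ‖Y‖ ^ 2 := by gcongr; exact le_abs_self C₂
    _ ≤ |C₂| * R ^ 2 :=
        mul_le_mul_of_nonneg_left (pow_le_pow_left₀ (norm_nonneg Y) hY.le 2) (abs_nonneg C₂)

variable [CompleteSpace 𝒳]

/-- **`QuadAnalytic` ⇒ Fréchet-holomorphic on the ball.**  The cell's hypothesis structure (quadratic bound + analyticity
along every complex line `ζ ↦ C(P + ζQ)` inside `‖Y‖ < R`) makes `C` bounded and Gâteaux-holomorphic on the ball, hence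
complex Fréchet-differentiable there by the Graves–Taylor–Hille–Zorn theorem (tree
`GateauxHolomorphic.differentiableOn_of_gateaux_of_bounded`). [cite: Chae1985, Thm 14.9 ((c) ⇒ (a))] -/
theorem differentiableOn_of_quadAnalytic (hC : QuadAnalytic C C₂ R) :
    DifferentiableOn ℂ C {Y : 𝒴 | ‖Y‖ < R} := by
  rw [← ball_zero_eq]
  refine GateauxHolomorphic.differentiableOn_of_gateaux_of_bounded (M := |C₂| * R ^ 2) ?_
    (fun Y hY => norm_le_of_quadAnalytic hC hY)
  intro a _ v
  have hs : {z : ℂ | a + z • v ∈ ball (0 : 𝒴) R} = {ζ : ℂ | ‖a + ζ • v‖ < R} := by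
    ext z
    exact mem_ball_zero_iff
  rw [hs]
  exact hC.lineAnalytic a v

/-- **`QuadAnalytic` ⇒ ANALYTIC on the ball** (`𝒴` any complex normed space, `𝒳` complete): Fréchet-holomorphic maps
of complex normed spaces are analytic ([Chae1985] Thm 14.13, tree `HolomorphicBanach.analyticOnNhd_of_differentiableOn`).
This is the binder `hCa : AnalyticOnNhd ℂ Ct {Y | ‖Y‖ < R}` of `B12LinearizAnalytic267`, `B10Eq17LocalSolution`,
`B13Eq119BPrime`, … DERIVED from `hC : QuadAnalytic Ct C₂ R`. [cite: Chae1985, Thm 14.13] -/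
theorem analyticOnNhd_of_quadAnalytic (hC : QuadAnalytic C C₂ R) :
    AnalyticOnNhd ℂ C {Y : 𝒴 | ‖Y‖ < R} :=
  HolomorphicBanach.analyticOnNhd_of_differentiableOn (differentiableOn_of_quadAnalytic hC)
    (isOpen_setOf_norm_lt R)

/-- `QuadAnalytic` ⇒ `C` is `C^∞` over `ℂ` on the ball. [cite: Chae1985, Thm 14.13] -/
theorem contDiffOn_of_quadAnalytic (hC : QuadAnalytic C C₂ R) {n : WithTop ℕ∞} :
    ContDiffOn ℂ n C {Y : 𝒴 | ‖Y‖ < R} :=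
  HolomorphicBanach.contDiffOn_omega (differentiableOn_of_quadAnalytic hC) (isOpen_setOf_norm_lt R)

end Ball

/-! ## §2 The discharges in the files of record (used BY NAME, untouched) -/

section B12

variable {𝒳 𝒴 : Type*} [NormedAddCommGroup 𝒳] [NormedSpace ℂ 𝒳] [CompleteSpace 𝒳]
  [NormedAddCommGroup 𝒴] [NormedSpace ℂ 𝒴]
  {hop : 𝒳 →ₗ[ℂ] 𝒴} {Ct : 𝒴 → 𝒳} {C₂ R b ε : ℝ} {Dt : 𝒴 → 𝒳}

/-- **[Balaban1987RG1] p. 267 «it is an analytic function of B»** for the chosen fixed point `D̃` of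
`B12Lineariz267`, from `QuadAnalytic C̃ C₂ R` and the contraction data ALONE (`𝒴` complete):
`B12LinearizAnalytic267.analyticOnNhd_Dt` with its binder `hCa` discharged. [cite: Balaban1987RG1, p.267] -/
theorem analyticOnNhd_Dt [CompleteSpace 𝒴] (hC : QuadAnalytic Ct C₂ R) (hC₂ : 0 ≤ C₂) (hb : 0 ≤ b)
    (hHop : ∀ X, ‖hop X‖ ≤ b * ‖X‖) (hq : 9 * C₂ * b * ε < 1) (hRC : 3 * ε ≤ R)
    (hDball : ∀ B : 𝒴, ‖B‖ < ε → Dt B ∈ closedBall (0:𝒳) (4 * C₂ * ε ^ 2))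
    (hDfix : ∀ B : 𝒴, ‖B‖ < ε → Ct (B - hop (Dt B)) = Dt B) :
    AnalyticOnNhd ℂ Dt (ball (0:𝒴) ε) :=
  B12LinearizAnalytic267.analyticOnNhd_Dt hC (analyticOnNhd_of_quadAnalytic hC) hC₂ hb hHop hq hRC hDball hDfix

/-- `D̃` is complex Fréchet-differentiable on `‖B‖ < ε`, from `QuadAnalytic` and the contraction data alone.
[cite: Balaban1987RG1, p.267] -/
theorem differentiableOn_Dt [CompleteSpace 𝒴] (hC : QuadAnalytic Ct C₂ R) (hC₂ : 0 ≤ C₂) (hb : 0 ≤ b)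
    (hHop : ∀ X, ‖hop X‖ ≤ b * ‖X‖) (hq : 9 * C₂ * b * ε < 1) (hRC : 3 * ε ≤ R)
    (hDball : ∀ B : 𝒴, ‖B‖ < ε → Dt B ∈ closedBall (0:𝒳) (4 * C₂ * ε ^ 2))
    (hDfix : ∀ B : 𝒴, ‖B‖ < ε → Ct (B - hop (Dt B)) = Dt B) :
    DifferentiableOn ℂ Dt (ball (0:𝒴) ε) :=
  (analyticOnNhd_Dt hC hC₂ hb hHop hq hRC hDball hDfix).differentiableOn

/-- **The headline of `B12LinearizAnalytic267` with the added analyticity binder removed**: analyticity of `D̃`,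
the derivative formula `DD̃(B₀) = (I + DC̃(Y₀)h)⁻¹DC̃(Y₀)` with its bound, analyticity and derivative of the change of
variables `Φ(B) = B − hD̃(B)` — all from `QuadAnalytic C̃ C₂ R` + the contraction data (`𝒴` complete).
[cite: Balaban1987RG1, p.267] -/
theorem p267_analytic_function_of_B [CompleteSpace 𝒴] (hC : QuadAnalytic Ct C₂ R) (hC₂ : 0 ≤ C₂) (hb : 0 ≤ b)
    (hHop : ∀ X, ‖hop X‖ ≤ b * ‖X‖) (hq : 9 * C₂ * b * ε < 1) (hRC : 3 * ε ≤ R)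
    (hDball : ∀ B : 𝒴, ‖B‖ < ε → Dt B ∈ closedBall (0:𝒳) (4 * C₂ * ε ^ 2))
    (hDfix : ∀ B : 𝒴, ‖B‖ < ε → Ct (B - hop (Dt B)) = Dt B) :
    AnalyticOnNhd ℂ Dt (ball (0:𝒴) ε) ∧
      (∀ B₀ : 𝒴, ‖B₀‖ < ε →
        (ContinuousLinearMap.id ℂ 𝒳 + fderiv ℂ Ct (B₀ - hop (Dt B₀)) ∘L hop.mkContinuous b hHop).IsInvertible ∧
        HasStrictFDerivAt Dt
          ((ContinuousLinearMap.id ℂ 𝒳 +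
              fderiv ℂ Ct (B₀ - hop (Dt B₀)) ∘L hop.mkContinuous b hHop).inverse ∘L
            fderiv ℂ Ct (B₀ - hop (Dt B₀))) B₀ ∧
        ‖fderiv ℂ Dt B₀‖ ≤ 9 * C₂ * ‖B₀‖ * (1 - 9 * C₂ * b * ε)⁻¹) ∧
      AnalyticOnNhd ℂ (fun B => B - hop (Dt B)) (ball (0:𝒴) ε) ∧
      (∀ B₀ : 𝒴, ‖B₀‖ < ε →
        HasStrictFDerivAt (fun B => B - hop (Dt B))
          (ContinuousLinearMap.id ℂ 𝒴 - hop.mkContinuous b hHop ∘L fderiv ℂ Dt B₀) B₀ ∧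
        ‖hop.mkContinuous b hHop ∘L fderiv ℂ Dt B₀‖ ≤ 9 * C₂ * b * ‖B₀‖ * (1 - 9 * C₂ * b * ε)⁻¹) :=
  B12LinearizAnalytic267.p267_analytic_function_of_B hC (analyticOnNhd_of_quadAnalytic hC) hC₂ hb hHop hq hRC
    hDball hDfix

end B12

section B10

variable {β C X : Type*} [Fintype β] [Fintype C] [NormedAddCommGroup X] [NormedSpace ℂ X] [CompleteSpace X]

/-- **Row B10.Eq17 ([Balaban1985UV3] (17) pp. 259–260) in r07's local reading `Eq17Local`, from `QuadAnalytic C̃ C₂ R`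
and the norm bound on `h` ALONE** — `B10Eq17LocalSolution.exists_eq17Local` with its binder
`hCa : AnalyticOnNhd ℂ Ct {Y | ‖Y‖ < R}` discharged by `analyticOnNhd_of_quadAnalytic`.
[cite: Balaban1985UV3, (17) pp.259–260] -/
theorem exists_eq17Local (b₀ : C → β) (h : C → X →ₗ[ℂ] X) {Ct : (β → X) → C → X} {C₂ R b ε : ℝ}
    (hC : QuadAnalytic Ct C₂ R) (hC₂ : 0 ≤ C₂) (hb : 0 ≤ b)
    (hh : ∀ c x, ‖h c x‖ ≤ b * ‖x‖) (hε : 0 < ε) (hq : 9 * C₂ * b * ε < 1) (hRC : 3 * ε ≤ R) :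
    ∃ Dt : (β → X) → (C → X),
      B10Eq17LocalSolution.Eq17Local ℂ b₀ (fun c => ⇑(h c)) Ct ε (4 * C₂ * ε ^ 2) Dt :=
  B10Eq17LocalSolution.exists_eq17Local b₀ h hC (analyticOnNhd_of_quadAnalytic hC) hC₂ hb hh hε hq hRC

/-- **«for A sufficiently small», the radius chosen** — `B10Eq17LocalSolution.exists_radius_eq17Local` without the
analyticity binder: for every `C̃` with `QuadAnalytic C̃ C₂ R`, `R > 0`, and every bounded placement `h`, there are
`ε > 0` and `D̃` with `Eq17Local ℂ b₀ h C̃ ε (4C₂ε²) D̃`. [cite: Balaban1985UV3, (17) pp.259–260] -/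
theorem exists_radius_eq17Local (b₀ : C → β) (h : C → X →ₗ[ℂ] X) {Ct : (β → X) → C → X} {C₂ R b : ℝ}
    (hC : QuadAnalytic Ct C₂ R) (hC₂ : 0 ≤ C₂) (hb : 0 ≤ b) (hh : ∀ c x, ‖h c x‖ ≤ b * ‖x‖) (hR : 0 < R) :
    ∃ ε : ℝ, 0 < ε ∧ ∃ Dt : (β → X) → (C → X),
      B10Eq17LocalSolution.Eq17Local ℂ b₀ (fun c => ⇑(h c)) Ct ε (4 * C₂ * ε ^ 2) Dt :=
  B10Eq17LocalSolution.exists_radius_eq17Local b₀ h hC (analyticOnNhd_of_quadAnalytic hC) hC₂ hb hh hR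

end B10

section B13

variable {𝒲 𝒴 𝒳 : Type*} [NormedAddCommGroup 𝒲] [NormedSpace ℂ 𝒲] [NormedAddCommGroup 𝒴] [NormedSpace ℂ 𝒴]
  [NormedAddCommGroup 𝒳] [NormedSpace ℂ 𝒳] [CompleteSpace 𝒳] [CompleteSpace 𝒴]
  {C : 𝒲 →L[ℂ] 𝒴} {hop : 𝒳 →ₗ[ℂ] 𝒴} {Dt : 𝒴 → 𝒳} {c₀ C₂ : ℝ} {Ct : 𝒴 → 𝒳} {R b ε : ℝ}

/-- **Row B13.Eq1.19 ([Balaban1988RG2Cluster] (1.19) p. 6): `Ψ₁ = (X ↦ X − hD̃(X)) ∘ C` is analytic on `‖w‖ < R₀`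
from [I] p. 267's data ALONE** — `B13Eq119BPrime.analyticOnNhd_psi1_of_lineariz` with its binder `hCa` discharged by
`analyticOnNhd_of_quadAnalytic`. [cite: Balaban1988RG2Cluster, (1.19) p.6] -/
theorem analyticOnNhd_psi1_of_quadAnalytic (hCt : QuadAnalytic Ct C₂ R) (hC₂ : 0 ≤ C₂) (hb : 0 ≤ b)
    (hHop : ∀ X, ‖hop X‖ ≤ b * ‖X‖) (hq : 9 * C₂ * b * ε < 1) (hRC : 3 * ε ≤ R)
    (hDball : ∀ B : 𝒴, ‖B‖ < ε → Dt B ∈ closedBall (0 : 𝒳) (4 * C₂ * ε ^ 2))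
    (hDfix : ∀ B : 𝒴, ‖B‖ < ε → Ct (B - hop (Dt B)) = Dt B)
    (hC : ∀ w, ‖C w‖ ≤ c₀ * ‖w‖) (hc₀ : 0 < c₀) {R₀ : ℝ} (hR : c₀ * R₀ ≤ ε) :
    AnalyticOnNhd ℂ (B13Eq119BPrime.psi1 C hop Dt) (ball (0 : 𝒲) R₀) :=
  B13Eq119BPrime.analyticOnNhd_psi1_of_lineariz hCt (analyticOnNhd_of_quadAnalytic hCt) hC₂ hb hHop hq hRC hDball
    hDfix hC hc₀ hR

end B13

end Literature.MathematicalPhysics.QuantumFieldTheory.Balaban1983to89.B13QuadAnalyticFrechet
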